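import Summits.HodgeConjecture.CorCM.MumfordTateRankProductRigidFactors
import Summits.HodgeConjecture.CorCM.MumfordTateRankSevenTypeThree
import Summits.HodgeConjecture.CorCM.MumfordTateRankEllipticProducts
import Summits.HodgeConjecture.CorCM.MumfordTateRankSubadditive
import Summits.HodgeConjecture.CorCM.CMAbelianFourfoldPowers
import Summits.HodgeConjecture.CorCM.AndreRiemannBiproducts
import Literature.AlgebraicGeometry.HodgeTheory.NoTypeIVFactorProducts
import Literature.AlgebraicGeometry.Pohlmann1968.SimpleCMAbelianVarietyPowersDivisorGenerated
import Literature.AlgebraicGeometry.Pohlmann1968.SimpleCMAbelianVarietyHazamaCriterion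
import Literature.Algebra.Lie.SemisimpleDimensionEight
import HarnessLib

/-!
# The Mumford–Tate rank of a product of THREE pairwise non-isogenous elliptic curves: `t = 3a + b + 1`
# (`a` non-CM curves, `b` CM curves) — in particular `Hg(E₁ × E₂ × E₃) = SL₂ × SL₂ × SL₂` for three non-CM curves

COR-CM (cell `pub-hodgecm2`, seat `b27` gen 47, count-neutral Mumford–Tate-rank ladder; theorems only, no definition, no named fact;
UNCONDITIONAL — nothing here uses or asserts HC_CM).  For `X ∼ ⨁_{j : Fin 3} E_j` with PAIRWISE NON-ISOGENOUS elliptic curves: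

* `mtRank_hodge_one_eq_four_of_biproduct_three_cm_curves` — all three CM: `t = 4` (the tree's CM-elliptic count `#C + 1`);
* `mtRank_hodge_one_eq_six/eight_…` — one / two non-CM curves: `t = 6`, `t = 8` (Moonen–Zarhin Thm. (3.2)(2): the non-CM part has
  no factor of type IV, `t(X) + 1 = t(non-CM part) + t(CM part)`);
* **`mtRank_hodge_one_eq_ten_of_biproduct_three_nonCM_curves`** — three NON-CM curves: **`t = 10`**, i.e. `dim Lie Hg = 9`,
  `Hg = SL₂³` (Imai 1976).  PROOF by elimination on the semisimple `𝔤 = Lie Hg(H¹X)` (no type IV): `dim 𝔤 ≤ 9` (subadditivity),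
  `dim 𝔤 ∉ {1, 2, 4, 5, 7}` (root count), `≠ 3` (`t = 4` forces ONE isotypic component, `X ∼ B^{m+1}`), `≠ 6` (`t = 7` with no type IV
  forces at most TWO isotypic components or an even dimension — gen-40/41 classification `classification_typeThree_…`), and `≠ 8`:
  an `8`-dimensional semisimple Lie algebra is SIMPLE and cannot map ONTO the `3`-dimensional `Lie Hg(H¹E₃)` — the restriction to the
  `Θ`-rigid factor `E₃` is surjective (`CorCM/MumfordTateRankProductRigidFactors`, `Motives/HodgeLieProductSimpleFactor`).
* `hasNoTypeIVFactor_biproduct_fin` — a finite biproduct of varieties without factor of type IV has none (plumbing).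

## References
* [MoonenZarhin1999LowDim] B. Moonen, Yu. G. Zarhin, Math. Ann. 315 (1999), §2 (2.1), §3 (3.1)–(3.4) (products of elliptic curves,
  after Imai) [corpus: paper:arxiv-math_9901113 pp. 5–7]. [cite: MoonenZarhin1999LowDim, §3 (3.1) and Thm. (3.2)(2)]
* [Hazama1983] F. Hazama, Tôhoku Math. J. 35 (1983), Lemma (3.1). [cite: Hazama1983, Lemma (3.1)]
* [Gordon1999HodgeAVSurvey] B. B. Gordon, *A survey of the Hodge conjecture for abelian varieties*, §7.5–7.6 (Imai's theorem).
  [cite: Gordon1999HodgeAVSurvey, 7.5 and 7.6.1]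
-/

noncomputable section

open scoped TensorProduct
open CategoryTheory CategoryTheory.Limits Module

namespace Summit.HodgeConjecture.CorCM

open Literature.AlgebraicGeometry.Motives
open Literature.AlgebraicGeometry.Motives.AbelianVariety
open Literature.AlgebraicGeometry.Motives.HodgeStructure
open Literature.AlgebraicGeometry.HodgeTheory
open Literature.AlgebraicGeometry.Milne1999 (IsOfCMType)
open Literature.AlgebraicGeometry.Pohlmann1968 (isIsogenous_powSucc_biproduct mtRank_hodge_one_eq_of_isIsogenous)
open Summit.HodgeConjecture.CorCM.Domination
open Summit.HodgeConjecture.CorCM.AndreRiemann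

variable [HodgeTensorFacts.{0, 0}] {X : AbelianVariety ℂ} {n : ℕ}

/-! ## §0 Plumbing: no factor of type IV in a finite biproduct; simple factors of `⨁ E` -/

omit [HodgeTensorFacts.{0, 0}] in
/-- A finite biproduct `⨁_{Fin (m+1)} f` of abelian varieties without factor of type IV has no factor of type IV
(`HasNoTypeIVFactor.prod` along `⨁_{Fin (m+1)} f ≅ f 0 × ⨁_{Fin m} (f ∘ succ)`). [cite: MoonenZarhin1999LowDim, §1 and Thm. (3.2)] -/
theorem hasNoTypeIVFactor_biproduct_fin : ∀ {m : ℕ} (f : Fin (m + 1) → AbelianVariety ℂ),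
    (∀ i, HasNoTypeIVFactor (f i)) → HasNoTypeIVFactor (⨁ f)
  | 0, f, hf => by
    have e : f = fun _ => f 0 := funext fun i => by fin_cases i; rfl
    rw [e]
    exact (hf 0).of_isIsogenous (isIsogenous_powSucc_biproduct (f 0) 0).symm'
  | m + 1, f, hf => by
    obtain ⟨h, g, hhg, hgh⟩ := biproduct_succ_split f
    have hh : IsIsogeny h := isIsogeny_of_comp_eq_of_comp_eq (isIsogeny_id _) (isIsogeny_id _) hgh hhg
    exact ((hf 0).prod (hasNoTypeIVFactor_biproduct_fin (f ∘ Fin.succ) fun i => hf i.succ)).of_isIsogenous ⟨h, hh⟩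

omit [HodgeTensorFacts.{0, 0}] in
/-- If `⨁_j E_j ∼ ⨁_{Fin (m+1)} B` with `B` simple, every positive-dimensional simple `E_j` is isogenous to `B` (uniqueness of simple
factors, Poincaré–Mumford). [cite: MumfordAV1970, §19 Thm. 1 and Cor. 1] -/
theorem isIsogenous_of_biproduct_isIsogenous_biproduct_const {J : Type} [Fintype J] {E : J → AbelianVariety ℂ}
    {B : AbelianVariety ℂ} {m : ℕ} (hBs : B.IsSimple) (h : IsIsogenous (⨁ E) (⨁ fun _ : Fin (m + 1) => B)) (j : J)
    (hEs : (E j).IsSimple) (hE0 : 0 < (E j).dim) : IsIsogenous (E j) B := by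
  obtain ⟨f, hf⟩ := h
  obtain ⟨-, hj⟩ := exists_isIsogenous_of_isSimple_of_avDominatedBy_biproduct (fun _ => hBs) hEs hE0
    ((avDominatedBy_biproduct_summand E j).trans_isIsogeny_hom hf)
  exact hj

omit [HodgeTensorFacts.{0, 0}] in
/-- If `⨁_j E_j ∼ B₁^{a+1} × B₂^{b+1}` with `B₁, B₂` simple, every positive-dimensional simple `E_j` is isogenous to `B₁` or to `B₂`.
[cite: MumfordAV1970, §19 Thm. 1 and Cor. 1] -/
theorem isIsogenous_or_of_biproduct_isIsogenous_powSucc_prod_powSucc {J : Type} [Fintype J] {E : J → AbelianVariety ℂ}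
    {B₁ B₂ : AbelianVariety ℂ} {a b : ℕ} (hB₁s : B₁.IsSimple) (hB₂s : B₂.IsSimple)
    (h : IsIsogenous (⨁ E) ((B₁.powSucc a).prod (B₂.powSucc b))) (j : J) (hEs : (E j).IsSimple) (hE0 : 0 < (E j).dim) :
    IsIsogenous (E j) B₁ ∨ IsIsogenous (E j) B₂ := by
  classical
  obtain ⟨f, hf⟩ := h
  have h₁ : AVDominatedBy (B₁.powSucc a) (⨁ fun _ : Fin (a + 1) => B₁) :=
    AVDominatedBy.of_isIsogenous (isIsogenous_powSucc_biproduct B₁ a) (AVDominatedBy.refl _)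
  have h₂ : AVDominatedBy (B₂.powSucc b) (⨁ fun _ : Fin (b + 1) => B₂) :=
    AVDominatedBy.of_isIsogenous (isIsogenous_powSucc_biproduct B₂ b) (AVDominatedBy.refl _)
  have hdom : AVDominatedBy (E j) (⨁ sumFam (fun _ : Fin (a + 1) => B₁) (fun _ : Fin (b + 1) => B₂)) :=
    ((avDominatedBy_biproduct_summand E j).trans_isIsogeny_hom hf).trans (avDominatedBy_prod_of_biproduct h₁ h₂)
  have hF : ∀ k, (sumFam (fun _ : Fin (a + 1) => B₁) (fun _ : Fin (b + 1) => B₂) k).IsSimple := by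
    rintro (k | k)
    · exact hB₁s
    · exact hB₂s
  obtain ⟨k, hk⟩ := exists_isIsogenous_of_isSimple_of_avDominatedBy_biproduct hF hEs hE0 hdom
  rcases k with k | k
  · exact Or.inl hk
  · exact Or.inr hk

/-! ## §1 The CM and mixed cases: `t = 4`, `6`, `8` -/

/-- **Three pairwise non-isogenous CM elliptic curves: `t(E₁ × E₂ × E₃) = 4`** (`Hg` a three-dimensional torus).
[cite: Gordon1999HodgeAVSurvey, 7.5 and 7.6.1] [cite: MoonenZarhin1999LowDim, §3 (3.4)] -/
theorem mtRank_hodge_one_eq_four_of_biproduct_three_cm_curves (hX : IsSmoothProjective n X.X) {E : Fin 3 → AbelianVariety ℂ}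
    (hE1 : ∀ j, (E j).dim = 1) (hcm : ∀ j, IsOfCMType (E j)) (hniso : ∀ j l, j ≠ l → ¬ IsIsogenous (E j) (E l))
    (hXE : IsIsogenous X (⨁ E)) :
    haveI := BettiUniverse.finite hX 1
    (BettiUniverse.hodge exists_isReal_hodgeModel_holds hX 1).mtRank = 4 := by
  have h := mtRank_hodge_one_eq_card_add_one_of_isIsogenous_biproduct_elliptic (C := Fin 3) (E := E) (m := 2) (cls := id)
    hE1 hcm hniso Function.surjective_id hX hXE
  simpa using h

omit [HodgeTensorFacts.{0, 0}] in
/-- Plumbing: `⨁_{Fin 3} E ∼ E 0 × (E 1 × E 2)`. [cite: MumfordAV1970, §19] -/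
theorem biproduct_three_isIsogenous_prod_prod (E : Fin 3 → AbelianVariety ℂ) :
    IsIsogenous (⨁ E) ((E 0).prod ((E 1).prod (E 2))) := by
  obtain ⟨h, g, hhg, hgh⟩ := biproduct_succ_split E
  have hh : IsIsogeny h := isIsogeny_of_comp_eq_of_comp_eq (isIsogeny_id _) (isIsogeny_id _) hgh hhg
  obtain ⟨h', g', hhg', hgh'⟩ := biproduct_succ_split (E ∘ Fin.succ)
  have hh' : IsIsogeny h' := isIsogeny_of_comp_eq_of_comp_eq (isIsogeny_id _) (isIsogeny_id _) hgh' hhg'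
  have e2 : (E ∘ Fin.succ) ∘ Fin.succ = fun _ : Fin 1 => E 2 := funext fun i => by
    rw [Subsingleton.elim i 0]; rfl
  have h3 : IsIsogenous (⨁ ((E ∘ Fin.succ) ∘ Fin.succ)) (E 2) := by
    rw [e2]
    exact (isIsogenous_powSucc_biproduct (E 2) 0).symm'
  have h12 : IsIsogenous (⨁ (E ∘ Fin.succ)) ((E 1).prod (E 2)) :=
    IsIsogenous.trans ⟨h', hh'⟩ ((IsIsogenous.refl _).prod h3)
  exact IsIsogenous.trans ⟨h, hh⟩ ((IsIsogenous.refl _).prod h12)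

/-- **One non-CM and two CM curves (pairwise non-isogenous): `t = 6`** (`t + 1 = t(E₀) + t(E₁ × E₂) = 4 + 3`).
[cite: MoonenZarhin1999LowDim, §3 Thm. (3.2)(2)] [cite: Gordon1999HodgeAVSurvey, 7.5 and 7.6.1] -/
theorem mtRank_hodge_one_eq_six_of_biproduct_curves (hX : IsSmoothProjective n X.X) {E : Fin 3 → AbelianVariety ℂ}
    (hE1 : ∀ j, (E j).dim = 1) (h0 : ¬ IsOfCMType (E 0)) (h1 : IsOfCMType (E 1)) (h2 : IsOfCMType (E 2))
    (h12 : ¬ IsIsogenous (E 1) (E 2)) (hXE : IsIsogenous X (⨁ E)) :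
    haveI := BettiUniverse.finite hX 1
    (BettiUniverse.hodge exists_isReal_hodgeModel_holds hX 1).mtRank = 6 := by
  have hsp : ∀ A : AbelianVariety ℂ, IsSmoothProjective A.dim A.X := fun A => AbelianVariety.isSmoothProjective_holds
  haveI := BettiUniverse.finite hX 1
  haveI : ∀ A : AbelianVariety ℂ, Module.Finite ℚ (bettiCohomology A.X 1) := fun A => BettiUniverse.finite (hsp A) 1
  obtain ⟨h4, -, hA4, -⟩ := curve_facts_of_not_isOfCMType (hE1 0) h0
  have h3 := mtRank_hodge_one_eq_three_of_isIsogenous_prod_curves (hsp ((E 1).prod (E 2))) (hE1 1) (hE1 2) h1 h2 h12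
    (IsIsogenous.refl _)
  have hcm12 : IsOfCMType ((E 1).prod (E 2)) := h1.prod h2
  have h := mtRank_hodge_one_add_one_eq_add_of_isIsogenous_prod hX (hsp (E 0)) (hsp ((E 1).prod (E 2))) (by rw [hE1 0]; omega)
    (by rw [dim_prod, hE1 1, hE1 2]; omega) hA4 hcm12 (hXE.trans (biproduct_three_isIsogenous_prod_prod E))
  omega

/-- **Two non-CM curves and one CM curve (pairwise non-isogenous): `t = 8`** (`t + 1 = t(E₁ × E₂) + t(E₀) = 7 + 2` with `E₀` the CM curve).
[cite: MoonenZarhin1999LowDim, §3 Thm. (3.2)(2)] [cite: Gordon1999HodgeAVSurvey, 7.5 and 7.6.1] -/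
theorem mtRank_hodge_one_eq_eight_of_biproduct_curves (hX : IsSmoothProjective n X.X) {E : Fin 3 → AbelianVariety ℂ}
    (hE1 : ∀ j, (E j).dim = 1) (h0 : IsOfCMType (E 0)) (h1 : ¬ IsOfCMType (E 1)) (h2 : ¬ IsOfCMType (E 2))
    (h12 : ¬ IsIsogenous (E 1) (E 2)) (hXE : IsIsogenous X (⨁ E)) :
    haveI := BettiUniverse.finite hX 1
    (BettiUniverse.hodge exists_isReal_hodgeModel_holds hX 1).mtRank = 8 := by
  have hsp : ∀ A : AbelianVariety ℂ, IsSmoothProjective A.dim A.X := fun A => AbelianVariety.isSmoothProjective_holds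
  haveI := BettiUniverse.finite hX 1
  haveI : ∀ A : AbelianVariety ℂ, Module.Finite ℚ (bettiCohomology A.X 1) := fun A => BettiUniverse.finite (hsp A) 1
  obtain ⟨-, -, hA1, -⟩ := curve_facts_of_not_isOfCMType (hE1 1) h1
  obtain ⟨-, -, hA2, -⟩ := curve_facts_of_not_isOfCMType (hE1 2) h2
  have h7 := mtRank_hodge_one_eq_seven_of_isIsogenous_prod_curves (hsp ((E 1).prod (E 2))) (hE1 1) (hE1 2) h1 h2 h12
    (IsIsogenous.refl _)
  have htwo := mtRank_hodge_one_eq_two_of_cm_curve (hE1 0) h0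
  have h := mtRank_hodge_one_add_one_eq_add_of_isIsogenous_prod hX (hsp ((E 1).prod (E 2))) (hsp (E 0))
    (by rw [dim_prod, hE1 1, hE1 2]; omega) (by rw [hE1 0]; omega) (hA1.prod hA2) h0
    ((hXE.trans (biproduct_three_isIsogenous_prod_prod E)).trans (isIsogenous_prod_comm _ _))
  omega

/-! ## §2 Three non-CM curves: `t = 10` -/

/-- **Three pairwise non-isogenous NON-CM elliptic curves: `dim MT(H¹(E₁ × E₂ × E₃)) = 10`** — `Lie Hg = 𝔰𝔩₂ ⊕ 𝔰𝔩₂ ⊕ 𝔰𝔩₂`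
(Imai): elimination `dim Lie Hg ∈ {3, 6, 8, 9} ∖ {3, 6, 8}` as explained in the module docstring.
[cite: MoonenZarhin1999LowDim, §3 (3.1) and (3.4)] [cite: Hazama1983, Lemma (3.1)] [cite: Gordon1999HodgeAVSurvey, 7.5 and 7.6.1] -/
theorem mtRank_hodge_one_eq_ten_of_biproduct_three_nonCM_curves (hX : IsSmoothProjective n X.X) {E : Fin 3 → AbelianVariety ℂ}
    (hE1 : ∀ j, (E j).dim = 1) (hcm : ∀ j, ¬ IsOfCMType (E j)) (hniso : ∀ j l, j ≠ l → ¬ IsIsogenous (E j) (E l))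
    (hXE : IsIsogenous X (⨁ E)) :
    haveI := BettiUniverse.finite hX 1
    (BettiUniverse.hodge exists_isReal_hodgeModel_holds hX 1).mtRank = 10 := by
  classical
  have hsp : ∀ A : AbelianVariety ℂ, IsSmoothProjective A.dim A.X := fun A => AbelianVariety.isSmoothProjective_holds
  haveI := BettiUniverse.finite hX 1
  haveI : ∀ A : AbelianVariety ℂ, Module.Finite ℚ (bettiCohomology A.X 1) := fun A => BettiUniverse.finite (hsp A) 1
  have hP := hsp (⨁ E)
  have hEs : ∀ j, (E j).IsSimple := fun j => isSimple_of_dim_le_one (hE1 j).le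
  have hfacts := fun j => curve_facts_of_not_isOfCMType (hE1 j) (hcm j)
  -- dimension and no type IV
  have hdim : (⨁ E).dim = 3 := by rw [dim_biproduct_fin]; simp [hE1]
  have h0 : 0 < (⨁ E).dim := by omega
  have hA4 : HasNoTypeIVFactor (⨁ E) := hasNoTypeIVFactor_biproduct_fin E fun j => (hfacts j).2.2.1
  have hncm : ¬ IsOfCMType (⨁ E) := not_isOfCMType_of_hasNoTypeIVFactor hP h0 hA4
  -- transfer to `⨁ E`
  rw [mtRank_hodge_one_eq_of_isIsogenous hX hP hXE]
  set t := (BettiUniverse.hodge exists_isReal_hodgeModel_holds hP 1).mtRank with ht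
  -- `4 ≤ t ≤ 10`, `t ∉ {5, 6, 8}`
  have hge := four_le_mtRank_hodge_one_of_not_isOfCMType hP hncm
  have hne := mtRank_hodge_one_ne_of_hasNoTypeIVFactor hP h0 hA4
  have hle : t ≤ 10 := by
    have h := mtRank_hodge_one_add_card_le_sum_add_one_of_isIsogenous_biproduct (A := E) (d := fun j => (E j).dim)
      (fun j => hsp (E j)) (fun j => by rw [hE1 j]; omega) hP h0 (IsIsogenous.refl _)
    have hs : ∑ j, (BettiUniverse.hodge exists_isReal_hodgeModel_holds (hsp (E j)) 1).mtRank = 12 := by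
      rw [Fin.sum_univ_three, (hfacts 0).1, (hfacts 1).1, (hfacts 2).1]
    simp only [Fintype.card_fin] at h
    omega
  -- `t ≠ 4`: one isotypic component
  have h4 : t ≠ 4 := fun h4 => by
    obtain ⟨B, m, hBs, -, -, hXB, -⟩ := exists_isIsogenous_power_of_not_isOfCMType hP h0 hncm h4.le
    exact hniso 0 1 (by decide) ((isIsogenous_of_biproduct_isIsogenous_biproduct_const hBs hXB 0 (hEs 0) (by rw [hE1 0]; omega)).trans
      (isIsogenous_of_biproduct_isIsogenous_biproduct_const hBs hXB 1 (hEs 1) (by rw [hE1 1]; omega)).symm')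
  -- `t ≠ 7`: at most two isotypic components, or an even dimension
  have h7 : t ≠ 7 := fun h7 => by
    rcases classification_typeThree_of_hasNoTypeIVFactor_of_mtRank_eq_seven hP h0 hA4 h7 with
      ⟨B₁, B₂, a, b, hB₁s, hB₂s, -, -, -, -, -, -, -, -, -, -, -, -, -, hXB, -, -⟩ | ⟨k, -, hk, -⟩ | ⟨B, m, -, -, -, -, -, -, hd, -⟩ |
      ⟨B, m, -, -, -, -, -, -, -, -, -, -, -, -, hd, -⟩
    · have hor := fun j => isIsogenous_or_of_biproduct_isIsogenous_powSucc_prod_powSucc hB₁s hB₂s hXB j (hEs j)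
        (by rw [hE1 j]; omega)
      rcases hor 0 with a0 | b0 <;> rcases hor 1 with a1 | b1 <;> rcases hor 2 with a2 | b2
      · exact hniso 0 1 (by decide) (a0.trans a1.symm')
      · exact hniso 0 1 (by decide) (a0.trans a1.symm')
      · exact hniso 0 2 (by decide) (a0.trans a2.symm')
      · exact hniso 1 2 (by decide) (b1.trans b2.symm')
      · exact hniso 1 2 (by decide) (a1.trans a2.symm')
      · exact hniso 0 2 (by decide) (b0.trans b2.symm')
      · exact hniso 0 1 (by decide) (b0.trans b1.symm')
      · exact hniso 0 1 (by decide) (b0.trans b1.symm')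
    · omega
    · omega
    · omega
  -- `t ≠ 9`: an `8`-dimensional semisimple Lie algebra is simple and does not map onto the `3`-dimensional `Lie Hg(H¹E₂)`
  have h9 : t ≠ 9 := fun h9 => by
    letI : LieRing (Module.End ℚ (bettiCohomology (⨁ E).X 1)) := LieRing.ofAssociativeRing
    letI : LieRing (Module.End ℚ (bettiCohomology (E 2).X 1)) := LieRing.ofAssociativeRing
    obtain ⟨𝔏, h𝔏⟩ := exists_lieSubalgebra_eq_hodgeLie (BettiUniverse.hodge exists_isReal_hodgeModel_holds hP 1)
    obtain ⟨𝔏₃, h𝔏₃⟩ := exists_lieSubalgebra_eq_hodgeLie (BettiUniverse.hodge exists_isReal_hodgeModel_holds (hsp (E 2)) 1)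
    haveI : LieAlgebra.IsSemisimple ℚ 𝔏 := (isSemisimple_of_eq_hodgeLie_hodge_one_of_hasNoTypeIVFactor hP hA4 𝔏 h𝔏).1
    haveI : Module.Finite ℚ 𝔏 := Module.Finite.of_injective 𝔏.toSubmodule.subtype Subtype.val_injective
    haveI : Module.Finite ℚ 𝔏₃ := Module.Finite.of_injective 𝔏₃.toSubmodule.subtype Subtype.val_injective
    have e𝔏 : Module.finrank ℚ 𝔏 = Module.finrank ℚ (BettiUniverse.hodge exists_isReal_hodgeModel_holds hP 1).hodgeLie := by
      rw [← h𝔏]; rfl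
    have e𝔏₃ : Module.finrank ℚ 𝔏₃ =
        Module.finrank ℚ (BettiUniverse.hodge exists_isReal_hodgeModel_holds (hsp (E 2)) 1).hodgeLie := by
      rw [← h𝔏₃]; rfl
    have h8 : Module.finrank ℚ 𝔏 = 8 := by
      have h := mtRank_hodge_one_eq_finrank_hodgeLie_add_one hP h0; omega
    have h3 : Module.finrank ℚ 𝔏₃ = 3 := by
      have h := mtRank_hodge_one_eq_finrank_hodgeLie_add_one (hsp (E 2)) (by rw [hE1 2]; omega)
      have h4 := (hfacts 2).1; omega
    haveI : LieAlgebra.IsSimple ℚ 𝔏 := Literature.Algebra.Lie.SemisimpleSmallDimension.isSimple_of_finrank_eq_eight h8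
    -- the retract of `E 2` in `⨁ E` and the restriction `𝔏 → 𝔏₃`, onto by rigidity of the non-CM curve `E 2`
    let ι := BettiUniverse.pullHodgeHom exists_isReal_hodgeModel_holds hodgePQ_independent_of_hodgeModel_holds hP (hsp (E 2))
      (biproduct.π E 2).hom.hom.hom 1
    let π := BettiUniverse.pullHodgeHom exists_isReal_hodgeModel_holds hodgePQ_independent_of_hodgeModel_holds (hsp (E 2)) hP
      (biproduct.ι E 2).hom.hom.hom 1
    have hπι : ∀ v, π.toLinearMap (ι.toLinearMap v) = v := fun v => pull_pull_eq_self_of_comp_eq_id (biproduct.ι_π_self E 2) v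
    obtain ⟨f, hf⟩ := exists_lieHom_restrict ι π hπι 𝔏 h𝔏 𝔏₃ h𝔏₃
    have hrig := hodgeLie_rigid_of_not_isOfCMType_of_mtRank_le_four (hsp (E 2)) (by rw [hE1 2]; omega) (hcm 2) (hfacts 2).1.le
    have hfs : Function.Surjective f := by
      rintro ⟨Y, hY⟩
      have hY' : Y ∈ (BettiUniverse.hodge exists_isReal_hodgeModel_holds (hsp (E 2)) 1).hodgeLie := by rw [← h𝔏₃]; exact hY
      obtain ⟨Z, hZ, hZY⟩ := exists_restrict_eq_of_rigid ι π hπι hrig hY'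
      refine ⟨⟨Z, by rw [← LieSubalgebra.mem_toSubmodule, h𝔏]; exact hZ⟩, Subtype.ext ?_⟩
      rw [hf]; exact hZY
    rcases LieAlgebra.IsSimple.eq_bot_or_eq_top f.ker with hk | hk
    · -- injective: `8 ≤ 3`
      have hinj : Function.Injective f := by rw [← LieHom.ker_eq_bot]; exact hk
      have h := LinearMap.finrank_le_finrank_of_injective (f := (f : 𝔏 →ₗ[ℚ] 𝔏₃)) hinj
      omega
    · -- zero map onto a `3`-dimensional algebra
      have hzero : ∀ x : 𝔏, f x = 0 := fun x => by
        have hx : x ∈ f.ker := by rw [hk]; exact LieSubmodule.mem_top x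
        exact LieHom.mem_ker.1 hx
      haveI : Subsingleton 𝔏₃ := ⟨fun a b => by
        obtain ⟨x, rfl⟩ := hfs a; obtain ⟨y, rfl⟩ := hfs b; rw [hzero, hzero]⟩
      have h := Module.finrank_zero_of_subsingleton (R := ℚ) (M := 𝔏₃)
      omega
  omega

end Summit.HodgeConjecture.CorCM

end
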